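import Literature.Analysis.FluidPDE.RieszPressureModConstPoisson
import Literature.Analysis.FluidPDE.BoundedMildPressureProbeBounds
import Literature.Analysis.FluidPDE.ProbeWeightBallAverage
import Mathlib.MeasureTheory.Function.L2Space
import HarnessLib

/-!
# The pressure of a bounded solution conserving momentum at infinity is the Riesz pressure
# modulo constants (KNSS 2009 §4; Seregin 2014 §6.2–6.3; Tao 2011 Lemma 4.1 (i))

Analysis/FluidPDE proofs file (all results proved; no definitions, no named facts). Let `(u, p)`
be a classical solution of the unforced Navier–Stokes system (`ν ≥ 0`) on `(t₁, t₂) × ℝ³` which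
is **bounded** (`‖u‖ ≤ N`, `|∂ᵢ∂ⱼ(uᵢuⱼ)| ≤ N_G`) and **conserves momentum at spatial infinity**:
`⨍_{B(c,ρ)} (u(s₂) − u(s₁)) → 0` as `ρ → ∞` for all times and centres (for bounded solutions of
the Oseen integral equation this is the tree's `tendsto_setAverage_oseenDuhamel` /
`tendsto_setAverage_heatExtension_sub`). Then for every `t`

  `p(t, ·) = pressurePotentialMod x₀ (u t) + C(t)`,

i.e. the classical pressure is the Riesz pressure `RᵢRⱼ(uᵢuⱼ)` modulo constants (Seregin 2014,
Thm 2.6 / Rem 6.2–6.4: the pressure of a bounded ancient solution is `p_{u⊗u} + b′(t)·x`, and the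
parasitic drift `b′` vanishes for mild solutions; KNSS 2009 §4). Proof: Tao's probe identity
for an arbitrary weak pressure (`fderiv_mollified_harmonicPart_eq`, with
`Q = pressurePotentialMod x₀ (u t)`, whose weak Poisson equation is
`integral_pressurePotentialMod_mul_laplacian`), the bounded-data bounds of
`BoundedMildPressureProbeBounds` for the viscous / transport / potential terms, and — the new
point — the time-INTEGRATED time-derivative term `∫⟪u(s₂) − u(s₁), Φ_R(x₁ − ·) a⟫ → 0`, which is
momentum conservation read through `ProbeWeightBallAverage`; a variant of the real-variable
uniqueness lemma of `HarmonicProbe` (increments of `W` instead of `W` itself are small) then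
gives `∇(θ ⋆ (p(t) − Q)) = 0`, and continuity upgrades the a.e. identity to every point.

## References

* G. Koch, N. Nadirashvili, G. Seregin, V. Šverák, Acta Math. 203 (2009) = arXiv:0709.3599,
  §3 Lemma 3.1 / Rem 3.1, §4. [KochNadirashviliSereginSverak2009]
* G. Seregin, *Lecture Notes on Regularity Theory for the Navier–Stokes Equations* (2014),
  §6.2 Lemma 6.5, Thm 2.6, Remarks 6.2–6.4, §6.3 Def 6.3. [Seregin2014]
* T. Tao, Anal. PDE 6 (2013) = arXiv:1108.1165, §4 Lemma 4.1 (i). [Tao2011]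
-/

noncomputable section

open MeasureTheory Set Filter Metric Function ContinuousLinearMap
open scoped Topology Laplacian ContDiff Convolution InnerProductSpace RealInnerProductSpace ENNReal

namespace Literature.Analysis.FluidPDE

namespace PressureNormalisation

open PressureNormalisationL3 ProbeWeight

/-! ### A real-variable uniqueness lemma with small increments -/

/-- **Uniqueness lemma, increment form.** Let `g : ℝ → ℝ`. Suppose that for all
`s₁, s₂ ∈ (a, b)` and every `ε > 0` there are `W, W'` with `W'` continuous on `(a, b)`,
`W' = dW/dt` there, `|W(s₂) − W(s₁)| ≤ ε` and `|g + W'| ≤ ε` on `(a, b)`. Then `g = 0` on `(a, b)`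
(the tree's `eq_zero_of_approx_antiderivative` asks `|W| ≤ ε`; here only increments are small).
[folklore] -/
private theorem eq_zero_of_approx_antiderivative_incr {g : ℝ → ℝ} {a b : ℝ}
    (h : ∀ s₁ ∈ Ioo a b, ∀ s₂ ∈ Ioo a b, ∀ ε > 0, ∃ W W' : ℝ → ℝ, ContinuousOn W' (Ioo a b) ∧
      (∀ t ∈ Ioo a b, HasDerivAt W (W' t) t) ∧ |W s₂ - W s₁| ≤ ε ∧
      ∀ t ∈ Ioo a b, |g t + W' t| ≤ ε) :
    ∀ t ∈ Ioo a b, g t = 0 := by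
  intro t₀ ht₀
  have hab : a < b := ht₀.1.trans ht₀.2
  have hg : ContinuousOn g (Ioo a b) := by
    refine continuousOn_of_approx fun ε hε => ?_
    obtain ⟨W, W', hW'c, -, -, hgW⟩ := h t₀ ht₀ t₀ ht₀ ε hε
    refine ⟨fun t => -W' t, hW'c.neg, fun y hy => ?_⟩
    rw [Real.dist_eq, sub_neg_eq_add]
    exact hgW y hy
  set G : ℝ → ℝ := fun s => ∫ τ in t₀..s, g τ with hG
  have hGd : ∀ s ∈ Ioo a b, HasDerivAt G (g s) s := by
    intro s hs
    have hsub : uIcc t₀ s ⊆ Ioo a b := ordConnected_Ioo.uIcc_subset ht₀ hs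
    exact intervalIntegral.integral_hasDerivAt_right ((hg.mono hsub).intervalIntegrable)
      (hg.stronglyMeasurableAtFilter isOpen_Ioo s hs) (hg.continuousAt (isOpen_Ioo.mem_nhds hs))
  have hGc : ∀ s₁ ∈ Ioo a b, ∀ s₂ ∈ Ioo a b, G s₁ = G s₂ := by
    intro s₁ hs₁ s₂ hs₂
    have key : ∀ ε > 0, |G s₂ - G s₁| ≤ (b - a + 1) * ε := by
      intro ε hε
      obtain ⟨W, W', -, hWd, hWb, hgW⟩ := h s₁ hs₁ s₂ hs₂ ε hε
      have hI : uIcc s₁ s₂ ⊆ Ioo a b := ordConnected_Ioo.uIcc_subset hs₁ hs₂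
      have hΦ : ∀ x ∈ uIcc s₁ s₂,
          HasDerivWithinAt (fun s => G s + W s) (g x + W' x) (uIcc s₁ s₂) x := fun x hx =>
        ((hGd x (hI hx)).add (hWd x (hI hx))).hasDerivWithinAt
      have hbound : ∀ x ∈ uIcc s₁ s₂, ‖g x + W' x‖ ≤ ε := fun x hx => by
        rw [Real.norm_eq_abs]; exact hgW x (hI hx)
      have hmvt := Convex.norm_image_sub_le_of_norm_hasDerivWithin_le hΦ hbound (convex_uIcc s₁ s₂)
        left_mem_uIcc right_mem_uIcc
      rw [Real.norm_eq_abs, Real.norm_eq_abs] at hmvt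
      have hs : |s₂ - s₁| ≤ b - a := by
        rw [abs_le]; constructor <;> linarith [hs₁.1, hs₁.2, hs₂.1, hs₂.2]
      calc |G s₂ - G s₁| = |((G s₂ + W s₂) - (G s₁ + W s₁)) - (W s₂ - W s₁)| := by ring_nf
        _ ≤ |(G s₂ + W s₂) - (G s₁ + W s₁)| + |W s₂ - W s₁| := abs_sub _ _
        _ ≤ ε * |s₂ - s₁| + ε := by gcongr
        _ ≤ ε * (b - a) + ε := by gcongr
        _ = (b - a + 1) * ε := by ring
    by_contra hne
    have hpos : 0 < |G s₂ - G s₁| := abs_pos.2 (sub_ne_zero.2 (Ne.symm hne))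
    have hba : 0 < b - a + 1 := by linarith
    have hk := key (|G s₂ - G s₁| / (2 * (b - a + 1))) (by positivity)
    have : (b - a + 1) * (|G s₂ - G s₁| / (2 * (b - a + 1))) = |G s₂ - G s₁| / 2 := by
      field_simp
    rw [this] at hk
    linarith
  have hconst : G =ᶠ[𝓝 t₀] fun _ => G t₀ := by
    filter_upwards [isOpen_Ioo.mem_nhds ht₀] with s hs using hGc s hs t₀ ht₀
  exact (hGd t₀ ht₀).unique ((hasDerivAt_const t₀ (G t₀)).congr_of_eventuallyEq hconst)

/-! ### `∇(θ ⋆ (p(t) − Q̃(t))) = 0` for bounded momentum-conserving solutions -/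

variable {ν : ℝ} {u : ℝ → EuclideanSpace ℝ (Fin 3) → EuclideanSpace ℝ (Fin 3)}
  {p : ℝ → EuclideanSpace ℝ (Fin 3) → ℝ}

/-- **`∇(θ ⋆ (p(t) − Q̃(t))) = 0`** for a bounded classical solution conserving momentum at
spatial infinity, `Q̃(t) = pressurePotentialMod x₀ (u t)` the Riesz pressure modulo constants
(Tao's probe identity; the three spatial terms are `O(R^{-1/2})` uniformly in time; the
time-integrated time-derivative term is an increment of `s ↦ ∫⟪u(s), Φ_R(x₁ − ·) a⟫`, small for
`R` large by momentum conservation). [cite: Tao2011, §4, proof of Lemma 4.1 (i); Seregin2014, §6.2 Rem 6.4] -/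
theorem fderiv_mollified_harmonicPart_eq_zero_bounded {t₁ t₂ : ℝ} (hν : 0 ≤ ν)
    (h : IsClassicalNSSolutionOn (Ioo t₁ t₂) ν 0 u p) {N NG : ℝ}
    (hN : ∀ t ∈ Ioo t₁ t₂, ∀ x, ‖u t x‖ ≤ N)
    (hG : ∀ t ∈ Ioo t₁ t₂, ∀ x, |pressureSource (u t) x| ≤ NG)
    (hmom : ∀ s₁ ∈ Ioo t₁ t₂, ∀ s₂ ∈ Ioo t₁ t₂, ∀ c : EuclideanSpace ℝ (Fin 3),
      Tendsto (fun ρ : ℝ => ⨍ y in ball c ρ, (u s₂ y - u s₁ y)) atTop (𝓝 0))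
    (x₀ : EuclideanSpace ℝ (Fin 3)) (φ : ContDiffBump (0 : EuclideanSpace ℝ (Fin 3)))
    (hφ : φ.rOut ≤ 1) (x₁ a : EuclideanSpace ℝ (Fin 3)) :
    ∀ t ∈ Ioo t₁ t₂,
      fderiv ℝ (φ.normed volume ⋆ fun x => p t x - pressurePotentialMod x₀ (u t) x) x₁ a = 0 := by
  have hS : IsOpen (Ioo t₁ t₂) := isOpen_Ioo
  -- constants
  obtain ⟨K₁, hK₁0, hK₁⟩ := exists_bound_laplacian_bounded φ hφ a
  obtain ⟨K₂, hK₂0, hK₂⟩ := exists_bound_transport_bounded φ hφ a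
  obtain ⟨K₄, hK₄0, hK₄⟩ := exists_bound_potential_bounded φ hφ a
  obtain ⟨A, hA0, hA⟩ := exists_abs_pressurePotentialMod_sub_le
  set B₀ : ℝ := 2 * NG * ∫ z, |newtonNear (1 : ℝ) 2 z| with hB₀
  set B₁ : ℝ := A * N ^ 2 with hB₁
  have hB₁0 : 0 ≤ B₁ := by positivity
  -- slice data
  have hreg : ∀ t ∈ Ioo t₁ t₂, ContDiff ℝ 4 (u t) := fun t ht =>
    contDiff_infty.1 (h.contDiff_velocity ht) 4
  have hcont : ∀ t ∈ Ioo t₁ t₂, Continuous (u t) := fun t ht => (hreg t ht).continuous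
  have hQc : ∀ t ∈ Ioo t₁ t₂, Continuous (pressurePotentialMod x₀ (u t)) := fun t ht =>
    continuous_pressurePotentialMod ((hreg t ht).of_le (by norm_num)) (hN t ht) x₀
  have hQeq : ∀ t ∈ Ioo t₁ t₂, ∀ ψ : EuclideanSpace ℝ (Fin 3) → ℝ, ContDiff ℝ ∞ ψ →
      HasCompactSupport ψ → ∫ y, pressurePotentialMod x₀ (u t) y * (Δ ψ) y =
        -∫ y, fderiv ℝ (fderiv ℝ ψ) y (u t y) (u t y) := fun t ht ψ hψ hψc =>
    integral_pressurePotentialMod_mul_laplacian (hreg t ht) (hN t ht) x₀ hψ hψc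
  have hgrowth : ∀ t ∈ Ioo t₁ t₂, ∀ y, |pressurePotentialMod x₀ (u t) (x₁ - y) -
      pressurePotentialMod x₀ (u t) x₁| ≤ B₀ + B₁ * Real.sqrt (1 + ‖y‖) := fun t ht y => by
    have := hA (u t) (hcont t ht) N NG (hN t ht) (hG t ht) x₀ (x₁ - y) x₁
    rw [sub_sub_cancel_left, norm_neg] at this
    simpa only [hB₀, hB₁] using this
  -- the error envelope `E(R) → 0`
  have hEt : Tendsto (fun R : ℝ => ν * (K₁ * N * R⁻¹) + K₂ * N ^ 2 * R⁻¹ + K₄ * B₀ * R⁻¹ +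
      K₄ * B₁ * (2 * (Real.sqrt R)⁻¹)) atTop (𝓝 0) := by
    have h1 : Tendsto (fun R : ℝ => R⁻¹) atTop (𝓝 0) := tendsto_inv_atTop_zero
    have h2 : Tendsto (fun R : ℝ => (Real.sqrt R)⁻¹) atTop (𝓝 0) :=
      tendsto_inv_atTop_zero.comp Real.tendsto_sqrt_atTop
    have := ((((h1.const_mul (K₁ * N)).const_mul ν).add (h1.const_mul (K₂ * N ^ 2))).add
      (h1.const_mul (K₄ * B₀))).add ((h2.const_mul 2).const_mul (K₄ * B₁))
    simpa using this
  set E : ℝ → ℝ := fun R => ν * (K₁ * N * R⁻¹) + K₂ * N ^ 2 * R⁻¹ + K₄ * B₀ * R⁻¹ +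
    K₄ * B₁ * (2 * (Real.sqrt R)⁻¹) with hEdef
  suffices hmain : ∀ t ∈ Ioo t₁ t₂, (fun τ => fderiv ℝ (φ.normed volume ⋆ fun x =>
      p τ x - pressurePotentialMod x₀ (u τ) x) x₁ a) t = 0 from fun t ht => hmain t ht
  refine eq_zero_of_approx_antiderivative_incr (a := t₁) (b := t₂) ?_
  intro s₁ hs₁ s₂ hs₂ ε hε
  -- momentum: the increment of `W_R` tends to zero
  set w : EuclideanSpace ℝ (Fin 3) → EuclideanSpace ℝ (Fin 3) := fun y => u s₂ y - u s₁ y with hw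
  have hwc : Continuous w := (hcont s₂ hs₂).sub (hcont s₁ hs₁)
  have hwN : ∀ y, ‖w y‖ ≤ N + N := fun y => (norm_sub_le _ _).trans (add_le_add (hN s₂ hs₂ y) (hN s₁ hs₁ y))
  have hmomR : Tendsto (fun R : ℝ => ‖a‖ * ‖∫ y, (probeBump R ⋆ φ.normed volume) (x₁ - y) • w y‖)
      atTop (𝓝 0) := by
    have := (tendsto_integral_probeConv_smul hwc hwN (hmom s₁ hs₁ s₂ hs₂) φ x₁).norm.const_mul ‖a‖
    simpa using this
  -- choose the scale
  obtain ⟨R, hR1, hER, hMR⟩ : ∃ R : ℝ, 1 ≤ R ∧ E R ≤ ε ∧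
      ‖a‖ * ‖∫ y, (probeBump R ⋆ φ.normed volume) (x₁ - y) • w y‖ ≤ ε := by
    have e1 : ∀ᶠ R : ℝ in atTop, E R ≤ ε := (hEt.eventually (ge_mem_nhds hε))
    have e2 : ∀ᶠ R : ℝ in atTop, ‖a‖ * ‖∫ y, (probeBump R ⋆ φ.normed volume) (x₁ - y) • w y‖ ≤ ε :=
      hmomR.eventually (ge_mem_nhds hε)
    obtain ⟨R, hR⟩ := ((e1.and e2).and (eventually_ge_atTop 1)).exists
    exact ⟨R, hR.2, hR.1.1, hR.1.2⟩
  have hR : 0 < R := one_pos.trans_le hR1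
  set Φ := probeBump R ⋆ φ.normed volume with hΦdef
  have hΦs : ContDiff ℝ ∞ Φ := contDiff_probeConv φ hR
  have hΦc : HasCompactSupport Φ := hasCompactSupport_probeConv φ hR
  have hΨs : ContDiff ℝ ∞ fun y : EuclideanSpace ℝ (Fin 3) => Φ (x₁ - y) • a :=
    (hΦs.comp (contDiff_const.sub contDiff_id)).smul contDiff_const
  have hΨc : HasCompactSupport fun y : EuclideanSpace ℝ (Fin 3) => Φ (x₁ - y) • a :=
    (hΦc.comp_homeomorph (Homeomorph.subLeft x₁)).smul_right (f' := fun _ => a)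
  have hΨcont : Continuous fun y : EuclideanSpace ℝ (Fin 3) => Φ (x₁ - y) • a := hΨs.continuous
  refine ⟨fun s => ∫ y, ⟪u s y, Φ (x₁ - y) • a⟫,
    fun s => ∫ y, ⟪FluidPDE.timeDerivWithin (Ioo t₁ t₂) u s y, Φ (x₁ - y) • a⟫,
    PressureNormalisationL3.continuousOn_integral_inner_timeDerivWithin h hS hΨcont hΨc,
    fun τ hτ => PressureNormalisationL3.hasDerivAt_integral_inner_velocity h hS hΨs hΨc hτ, ?_,
    fun τ hτ => ?_⟩
  · -- `|W(s₂) − W(s₁)| ≤ ε`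
    have hi : ∀ s ∈ Ioo t₁ t₂, Integrable fun y => ⟪u s y, Φ (x₁ - y) • a⟫ := fun s hs =>
      ((hcont s hs).inner hΨcont).integrable_of_hasCompactSupport
        (HasCompactSupport.intro hΨc.isCompact fun y hy => by
          rw [image_eq_zero_of_notMem_tsupport hy, inner_zero_right])
    have hvi : Integrable fun y => Φ (x₁ - y) • w y :=
      ((hΦs.continuous.comp (continuous_const.sub continuous_id)).smul hwc).integrable_of_hasCompactSupport
        ((hΦc.comp_homeomorph (Homeomorph.subLeft x₁)).smul_right (f' := w))
    have e : (∫ y, ⟪u s₂ y, Φ (x₁ - y) • a⟫) - ∫ y, ⟪u s₁ y, Φ (x₁ - y) • a⟫ =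
        ⟪a, ∫ y, Φ (x₁ - y) • w y⟫ := by
      rw [← integral_sub (hi s₂ hs₂) (hi s₁ hs₁), ← integral_inner hvi]
      refine integral_congr_ae (Eventually.of_forall fun y => ?_)
      show ⟪u s₂ y, Φ (x₁ - y) • a⟫ - ⟪u s₁ y, Φ (x₁ - y) • a⟫ = ⟪a, Φ (x₁ - y) • w y⟫
      rw [← inner_sub_left, hw, real_inner_smul_right, real_inner_smul_right, real_inner_comm]
    rw [e]
    exact (abs_real_inner_le_norm _ _).trans hMR
  · -- `|g + W'| ≤ ε` by the probe identity and the three bounds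
    have key := fderiv_mollified_harmonicPart_eq h hS hτ (hQc τ hτ).locallyIntegrable
      (hQeq τ hτ) φ hR x₁ a
    rw [key]
    dsimp only
    have b1 := hK₁ (u τ) N (hcont τ hτ) (hN τ hτ) R hR1 x₁
    have b2 := hK₂ (u τ) N (hcont τ hτ) (hN τ hτ) R hR1 x₁
    have b4 := hK₄ (pressurePotentialMod x₀ (u τ)) B₀ B₁ x₁ (hQc τ hτ) hB₁0 (hgrowth τ hτ) R hR1
    generalize (∫ y, ⟪u τ y, (Δ (fun y => Φ (x₁ - y))) y • a⟫) = Aν at b1 ⊢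
    generalize (∫ y, ⟪u τ y, fderiv ℝ (fun y => Φ (x₁ - y)) y (u τ y) • a⟫) = Bt at b2 ⊢
    generalize (∫ y, fderiv ℝ Φ y a * pressurePotentialMod x₀ (u τ) (x₁ - y)) = D at b4 ⊢
    generalize (∫ y, ⟪FluidPDE.timeDerivWithin (Ioo t₁ t₂) u τ y, Φ (x₁ - y) • a⟫) = C
    have e : ν * Aν + Bt - C - D + C = ν * Aν + Bt - D := by ring
    rw [e]
    -- compare with the envelope `E(R)`
    have hR2 : R⁻¹ ^ 2 ≤ R⁻¹ := by
      have h1 : R⁻¹ ≤ 1 := inv_le_one_of_one_le₀ hR1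
      have h0 : 0 ≤ R⁻¹ := by positivity
      nlinarith
    have hsq : Real.sqrt (2 + 2 * R) * R⁻¹ ≤ 2 * (Real.sqrt R)⁻¹ := by
      have hsR : 0 < Real.sqrt R := Real.sqrt_pos.2 hR
      have h1 : Real.sqrt (2 + 2 * R) ≤ 2 * Real.sqrt R := by
        rw [show (2 : ℝ) * Real.sqrt R = Real.sqrt (2 ^ 2 * R) by
          rw [Real.sqrt_mul (by norm_num), Real.sqrt_sq (by norm_num)]]
        exact Real.sqrt_le_sqrt (by linarith)
      have h2 : R⁻¹ = (Real.sqrt R)⁻¹ * (Real.sqrt R)⁻¹ := by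
        rw [← mul_inv, Real.mul_self_sqrt hR.le]
      rw [h2]
      calc Real.sqrt (2 + 2 * R) * ((Real.sqrt R)⁻¹ * (Real.sqrt R)⁻¹)
          ≤ (2 * Real.sqrt R) * ((Real.sqrt R)⁻¹ * (Real.sqrt R)⁻¹) :=
            mul_le_mul_of_nonneg_right h1 (by positivity)
        _ = 2 * (Real.sqrt R)⁻¹ := by field_simp
    have hN0 : 0 ≤ N := (norm_nonneg _).trans (hN τ hτ 0)
    have hB₀0 : 0 ≤ B₀ := by
      have := hgrowth τ hτ 0
      rw [sub_zero, sub_self, abs_zero, norm_zero, add_zero, Real.sqrt_one, mul_one] at this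
      have hNG : 0 ≤ NG := (abs_nonneg _).trans (hG τ hτ 0)
      rw [hB₀]; exact mul_nonneg (mul_nonneg two_pos.le hNG) (integral_nonneg fun _ => abs_nonneg _)
    calc |ν * Aν + Bt - D| ≤ ν * |Aν| + |Bt| + |D| := by
          calc |ν * Aν + Bt - D| ≤ |ν * Aν + Bt| + |D| := abs_sub _ _
            _ ≤ |ν * Aν| + |Bt| + |D| := by gcongr; exact abs_add_le _ _
            _ = ν * |Aν| + |Bt| + |D| := by rw [abs_mul, abs_of_nonneg hν]
      _ ≤ ν * (K₁ * N * R⁻¹ ^ 2) + K₂ * N ^ 2 * R⁻¹ + K₄ * (B₀ + B₁ * Real.sqrt (2 + 2 * R)) * R⁻¹ := by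
          gcongr
      _ ≤ E R := by
          simp only [hEdef]
          have t1 : ν * (K₁ * N * R⁻¹ ^ 2) ≤ ν * (K₁ * N * R⁻¹) :=
            mul_le_mul_of_nonneg_left (mul_le_mul_of_nonneg_left hR2 (by positivity)) hν
          have t3 : K₄ * (B₀ + B₁ * Real.sqrt (2 + 2 * R)) * R⁻¹ =
              K₄ * B₀ * R⁻¹ + K₄ * B₁ * (Real.sqrt (2 + 2 * R) * R⁻¹) := by ring
          have t4 : K₄ * B₁ * (Real.sqrt (2 + 2 * R) * R⁻¹) ≤ K₄ * B₁ * (2 * (Real.sqrt R)⁻¹) :=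
            mul_le_mul_of_nonneg_left hsq (by positivity)
          linarith
      _ ≤ ε := hER

/-- **The pressure of a bounded, momentum-conserving classical solution is the Riesz pressure
modulo constants** (Koch–Nadirashvili–Seregin–Šverák 2009, §4; Seregin 2014, Thm 2.6 with
Rem 6.4 and Def 6.3: for mild bounded ancient solutions the drift `b′(t)·x` is absent; Tao 2011,
Lemma 4.1 (i)). Let `(u, p)` be a classical solution of the unforced system (`ν ≥ 0`) on
`(t₁, t₂)` with `‖u‖ ≤ N`, `|∂ᵢ∂ⱼ(uᵢuⱼ)| ≤ N_G`, and `⨍_{B(c,ρ)} (u(s₂) − u(s₁)) → 0` as `ρ → ∞`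
for all `s₁, s₂ ∈ (t₁, t₂)` and all centres `c`. Then for every `t ∈ (t₁, t₂)` and every base
point `x₀` there is a constant `C` with `p(t, x) = pressurePotentialMod x₀ (u t) x + C` for ALL `x`.
[cite: Seregin2014, §6.2 Thm 2.6, Remarks 6.2–6.4; KochNadirashviliSereginSverak2009, §4] -/
theorem pressure_eq_pressurePotentialMod_add_const {t₁ t₂ : ℝ} (hν : 0 ≤ ν)
    (h : IsClassicalNSSolutionOn (Ioo t₁ t₂) ν 0 u p) {N NG : ℝ}
    (hN : ∀ t ∈ Ioo t₁ t₂, ∀ x, ‖u t x‖ ≤ N)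
    (hG : ∀ t ∈ Ioo t₁ t₂, ∀ x, |pressureSource (u t) x| ≤ NG)
    (hmom : ∀ s₁ ∈ Ioo t₁ t₂, ∀ s₂ ∈ Ioo t₁ t₂, ∀ c : EuclideanSpace ℝ (Fin 3),
      Tendsto (fun ρ : ℝ => ⨍ y in ball c ρ, (u s₂ y - u s₁ y)) atTop (𝓝 0))
    (x₀ : EuclideanSpace ℝ (Fin 3)) {t : ℝ} (ht : t ∈ Ioo t₁ t₂) :
    ∃ C : ℝ, ∀ x, p t x = pressurePotentialMod x₀ (u t) x + C := by
  have hreg : ContDiff ℝ 4 (u t) := contDiff_infty.1 (h.contDiff_velocity ht) 4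
  have hQc : Continuous (pressurePotentialMod x₀ (u t)) :=
    continuous_pressurePotentialMod (hreg.of_le (by norm_num)) (hN t ht) x₀
  set g : EuclideanSpace ℝ (Fin 3) → ℝ := fun x => p t x - pressurePotentialMod x₀ (u t) x with hg
  have hgc : Continuous g := (h.contDiff_pressure ht).continuous.sub hQc
  have hgli : LocallyIntegrable g volume := hgc.locallyIntegrable
  -- every mollification is constant
  have hconst : ∀ ψ : ContDiffBump (0 : EuclideanSpace ℝ (Fin 3)), ψ.rOut ≤ 1 →
      ∃ c : ℝ, ∀ x, (ψ.normed volume ⋆ g) x = c := by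
    intro ψ hψ
    have hcd : ContDiff ℝ 1 (ψ.normed volume ⋆ g) :=
      ψ.hasCompactSupport_normed.contDiff_convolution_left _ ψ.contDiff_normed hgli
    have hdiff : Differentiable ℝ (ψ.normed volume ⋆ g) := hcd.differentiable one_ne_zero
    refine ⟨(ψ.normed volume ⋆ g) 0, fun x => is_const_of_fderiv_eq_zero hdiff (fun y => ?_) x 0⟩
    ext b
    rw [fderiv_mollified_harmonicPart_eq_zero_bounded hν h hN hG hmom x₀ ψ hψ y b t ht]
    rfl
  obtain ⟨C, hC⟩ := ConvolutionLaplacian.ae_eq_const_of_forall_convolution_normed_const hgli hconst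
  have hall : g = fun _ => C :=
    (hgc.ae_eq_iff_eq volume continuous_const).1 hC
  refine ⟨C, fun x => ?_⟩
  have := congr_fun hall x
  simp only [hg] at this
  linarith

end PressureNormalisation

end Literature.Analysis.FluidPDE

end
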